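import Literature.NumberTheory.LFunctions.ZeroFreeRegionUpTo
import Literature.NumberTheory.LFunctions.ExplicitPNTNonExceptionalModuli
import Literature.NumberTheory.LFunctions.NonExceptionalModuliPNT
import HarnessLib

/-!
# No exceptional zero for quadratic characters to moduli `q ≤ 10¹⁰` (Lu–Zaman–Zhao 2026) and the
# kernel consequences over that range

Topic `Literature/NumberTheory/LFunctions`; namespace `Literature.NumberTheory.LFunctions`. TWO named
facts AS PRINTED (Lu–Zaman–Zhao, Theorem 1.1 and Corollary 1.3; D-0014, not discharged — a
150 000-core-hour certified computation) and THEOREMS: the printed frontier of the no-exceptional-zero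
column in the vocabulary of `NoExceptionalZeroUpTo.lean`, with its consumers instantiated at `Q = 10¹⁰`.

## What the source prints

R. F. Lu, A. Zaman, H. Zhao, *Numerical computations concerning Landau–Siegel zeros*, Math. Comp.
(2026), doi:10.1090/mcom/4268 = arXiv:2602.03626 (held; p. 1 and p. 3 read):

* "(1.1) `σ ≥ 1 − c/log max(q, q|t|, 10)`, where `s = σ + it` … for all integers `q ≥ 3`, the function
  `∏_{χ (mod q)} L(s, χ)` has at most one zero … an explicit value of `c = 1/10` follows from work of
  McCurley".
* **Theorem 1.1.** "If `q ≤ 10¹⁰` and `χ` is a quadratic Dirichlet character modulo `q`, then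
  `L(σ, χ) ≠ 0` for `σ ≥ 1 − 1/(5 log q)`."
* **Corollary 1.2.** "If `q ≤ 10¹⁰` then `∏_{χ (mod q)} L(s, χ)` has no zeros in region (1.1) with
  `c = 1/10`." ("Combined with McCurley's zero-free region".)
* **Corollary 1.3.** "If `q ≤ 10¹⁰` and `χ` is a primitive quadratic character modulo `q`, then
  `L(1, χ) ≥ 1/(8 log q)`."
* §3: "For `q ≤ 4×10⁵`, we apply Platt's result. For `4×10⁵ < q ≤ 10¹⁰` …" (their Theorem 2.1
  inequality, FLINT/Arb, one lineage).

## Contents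

* `luZamanZhao2026_theorem11`, `luZamanZhao2026_corollary13` — named facts as printed ("quadratic
  Dirichlet character" = real non-principal, `MulChar.IsQuadratic ∧ χ ≠ 1`; `σ` real; `L(1, χ)` on
  its real part).
* `noExceptionalZeroUpTo_of_luZamanZhao : luZamanZhao2026_theorem11 → NoExceptionalZeroUpTo (10^10) (1/5)`
  — the frontier as an instance of the column's criterion (`1/(5 log q) = (1/5)/log q`).
* `luZamanZhao2026_corollary12_of` — **Corollary 1.2 PROVED from Theorem 1.1 and McCurley's
  Theorem 1** (both named facts): for `3 ≤ q ≤ 10¹⁰`, every `χ` mod `q` and every `s ≠ 1` with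
  `Re s ≥ 1 − 1/(10 log max(q, q|Im s|, 10))`, `L(s, χ) ≠ 0` (the closed `c = 1/10` region lies in
  McCurley's open `R₁ = 9.645908801` region, which is exception-free by
  `zeroFreeRegionUpTo_of_noExceptionalZeroUpTo` at `c₀ = 1/5 ≥ 1/R₁`). `s ≠ 1` only removes
  Mathlib's junk value of the principal `L`-function at its pole.
* `BMOR2018.psi_bound_luZamanZhao` — the explicit `ψ(x; q, a)` consumer over the whole range:
  `luZamanZhao2026_theorem11 → BMOR2018.lemma612_psi →` for `10⁵ ≤ q ≤ 10¹⁰`, units `a`,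
  `x ≥ exp(4R₁ log² q)`: `|ψ(x; q, a) − x/φ(q)| ≤ 1.4579 x √(log x/R₁) exp(−√(log x/R₁))`, and
  `BMOR2018.psi_bound_log_sq_luZamanZhao`: `≤ x/(5 log² x)` in the same range.
* `chebyshevPsiMod_bound_luZamanZhao` — the inexplicit-constant Page–Siegel–Walfisz estimate of
  `NonExceptionalModuliPNT.lean` for ALL `1 ≤ q ≤ 10¹⁰`, `x ≥ 2`, with absolute `k, m`.

What is NOT here: LZZ's Theorem 2.1 (the certificate inequality) and any row-level certificate
checker — the DATA rung of the column; Watkins/Chua wide tables.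

## References

* R. F. Lu, A. Zaman, H. Zhao, Math. Comp. (2026), doi:10.1090/mcom/4268 = arXiv:2602.03626,
  Theorem 1.1, Corollaries 1.2–1.3, (1.1), §3. [LuZamanZhao2026]
* K. S. McCurley, J. Number Theory 19 (1984) 7–32, Theorem 1. [McCurley1984ZFR]
* M. A. Bennett, G. Martin, K. O'Bryant, A. Rechnitzer, Illinois J. Math. 62 (2018), Lemma 6.12.
  [BennettMartinOBryantRechnitzer2018]
-/

noncomputable section

open Complex

namespace Literature.NumberTheory.LFunctions

/-! ### The printed frontier as named facts -/

/-- **Lu–Zaman–Zhao 2026, Theorem 1.1 (as printed, p. 1): "If `q ≤ 10¹⁰` and `χ` is a quadratic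
Dirichlet character modulo `q`, then `L(σ, χ) ≠ 0` for `σ ≥ 1 − 1/(5 log q)`."** Rendering:
"quadratic Dirichlet character" = real-valued and non-principal (`MulChar.IsQuadratic`, `χ ≠ χ₀`;
imprimitive ones included, as printed — their real zeros in `(0, 1)` are those of the primitive
inducer of conductor `≤ q`); `σ` real (the window lies in `(0, 1]` since `5 log q > 1`); `L` is
Mathlib's `DirichletCharacter.LFunction`. A certified FLINT/Arb computation of about 150 000 core
hours (§3; Platt's GRH verification for `q ≤ 4·10⁵`, the inequality of their Theorem 2.1 beyond);
single lineage; not discharged here. [cite: LuZamanZhao2026, Theorem 1.1] -/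
def luZamanZhao2026_theorem11 : Prop :=
  ∀ (q : ℕ) [NeZero q], q ≤ 10 ^ 10 → ∀ χ : DirichletCharacter ℂ q, χ.IsQuadratic → χ ≠ 1 →
    ∀ σ : ℝ, 1 - 1 / (5 * Real.log q) ≤ σ → χ.LFunction σ ≠ 0

/-- **Lu–Zaman–Zhao 2026, Corollary 1.3 (as printed, p. 3): "If `q ≤ 10¹⁰` and `χ` is a primitive
quadratic character modulo `q`, then `L(1, χ) ≥ 1/(8 log q)`."** (`L(1, χ)` is real for real `χ`;
rendered on the real part. Proof in print: Theorem 1.1 with Hoffstein's inequality for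
`q > 10⁶`, direct FLINT evaluation below; not discharged here.) [cite: LuZamanZhao2026, Corollary 1.3] -/
def luZamanZhao2026_corollary13 : Prop :=
  ∀ (q : ℕ) [NeZero q], q ≤ 10 ^ 10 → ∀ χ : DirichletCharacter ℂ q, χ.IsQuadratic → χ ≠ 1 →
    χ.IsPrimitive → 1 / (8 * Real.log q) ≤ (χ.LFunction 1).re

/-! ### The frontier as an instance of the criterion -/

/-- **Theorem 1.1 ⇒ `NoExceptionalZeroUpTo 10¹⁰ (1/5)`**: the printed frontier of the narrow column
(`1/(5 log q) = (1/5)/log q`; primitive quadratic characters of modulus `≥ 3` are non-principal).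
[cite: LuZamanZhao2026, Theorem 1.1] -/
theorem noExceptionalZeroUpTo_of_luZamanZhao (h : luZamanZhao2026_theorem11) :
    NoExceptionalZeroUpTo (10 ^ 10) (1 / 5) := by
  intro q _ hq3 hqQ χ hquad hprim σ _ hσ _
  have hne : χ ≠ 1 := SiegelZeroQuality.ne_one_of_isPrimitive hprim (by omega)
  refine h q hqQ χ hquad hne σ ?_
  have : 1 / (5 * Real.log (q : ℝ)) = 1 / 5 / Real.log q := by rw [div_div]
  rw [this]
  exact hσ

/-- **Lu–Zaman–Zhao Corollary 1.2, PROVED from Theorem 1.1 and McCurley's Theorem 1** (both named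
facts): for every modulus `3 ≤ q ≤ 10¹⁰`, every Dirichlet character `χ` mod `q` and every `s ≠ 1` with
`Re s ≥ 1 − 1/(10 log max(q, q|Im s|, 10))` (region (1.1) with `c = 1/10`), `L(s, χ) ≠ 0`. The closed
`c = 1/10` region lies inside McCurley's open region with `R₁ = 9.645908801 < 10`, which is free of
zeros up to `10¹⁰` by `zeroFreeRegionUpTo_of_noExceptionalZeroUpTo` (`c₀ = 1/5`, `R₁ · (1/5) ≥ 1`).
The hypothesis `s ≠ 1` only keeps Mathlib's finite junk value of the principal `L`-function at its
pole out of the statement (print: "has no zeros", a pole being no zero).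
[cite: LuZamanZhao2026, Corollary 1.2] -/
theorem luZamanZhao2026_corollary12_of (h11 : luZamanZhao2026_theorem11)
    (hM : McCurley1984_theorem1) {q : ℕ} [NeZero q] (hq3 : 3 ≤ q) (hqQ : q ≤ 10 ^ 10)
    (χ : DirichletCharacter ℂ q) {s : ℂ} (hs : s ≠ 1)
    (hr : 1 - 1 / (10 * Real.log (max (max (q : ℝ) ((q : ℝ) * |s.im|)) 10)) ≤ s.re) :
    χ.LFunction s ≠ 0 := by
  have hZ : ZeroFreeRegionUpTo (10 ^ 10) 9.645908801 10 :=
    zeroFreeRegionUpTo_of_noExceptionalZeroUpTo hM (by norm_num)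
      (noExceptionalZeroUpTo_of_luZamanZhao h11) le_rfl (by norm_num) (by norm_num)
  refine hZ q hq3 hqQ χ s hs (lt_of_lt_of_le ?_ hr)
  -- `1 − 1/(9.645908801 log M) < 1 − 1/(10 log M)` since `log M > 0`
  have hq3r : (3 : ℝ) ≤ (q : ℝ) := by exact_mod_cast hq3
  have hM10 : (10 : ℝ) ≤ max (max (q : ℝ) ((q : ℝ) * |s.im|)) 10 := le_max_right _ _
  have hlogM : 0 < Real.log (max (max (q : ℝ) ((q : ℝ) * |s.im|)) 10) :=
    Real.log_pos (by linarith)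
  have h1 : 1 / (10 * Real.log (max (max (q : ℝ) ((q : ℝ) * |s.im|)) 10)) <
      1 / (9.645908801 * Real.log (max (max (q : ℝ) ((q : ℝ) * |s.im|)) 10)) := by
    apply one_div_lt_one_div_of_lt
    · positivity
    · nlinarith
  linarith

/-- **The explicit `ψ(x; q, a)` bound over the whole printed range** (conditional on the two named
facts `luZamanZhao2026_theorem11` and `BMOR2018.lemma612_psi`): for every modulus
`10⁵ ≤ q ≤ 10¹⁰`, every unit `a` mod `q` and every `x ≥ exp(4R₁ log² q)`,
`|ψ(x; q, a) − x/φ(q)| ≤ 1.4579 · x · √(log x/R₁) · exp(−√(log x/R₁))`, `R₁ = 9.645908801`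
(`c₀ = 1/5 ≥ 1/R₁`). Bennett–Martin–O'Bryant–Rechnitzer could assert this for `q ≤ 4·10⁵` only.
[cite: BennettMartinOBryantRechnitzer2018, Lemma 6.12 and Proposition 6.18] -/
theorem BMOR2018.psi_bound_luZamanZhao (h11 : luZamanZhao2026_theorem11)
    (h612 : BMOR2018.lemma612_psi) {q : ℕ} [NeZero q] (hq : 10 ^ 5 ≤ q) (hqQ : q ≤ 10 ^ 10)
    (a : (ZMod q)ˣ) {x : ℝ} (hx : Real.exp (4 * BMOR2018.R₁ * Real.log q ^ 2) ≤ x) :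
    |Literature.NumberTheory.Sieve.ParityWave0.chebyshevPsiMod q a x - x / q.totient| ≤
      BMOR2018.errTerm x :=
  BMOR2018.psi_bound_of_noExceptionalZeroUpTo h612 (noExceptionalZeroUpTo_of_luZamanZhao h11)
    (by unfold BMOR2018.R₁; norm_num) hq hqQ a hx


/-- **Log-power form over the whole printed range** (`Z = 2` instance of Bennett–Martin–O'Bryant–
Rechnitzer's Lemma 6.14, proved in `ExplicitPNTNonExceptionalModuli.lean`): under the two named facts,
for every modulus `10⁵ ≤ q ≤ 10¹⁰`, every unit `a` mod `q` and every `x ≥ exp(4R₁ log² q)`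
(`4R₁ = 38.583635204`), `|ψ(x; q, a) − x/φ(q)| ≤ x/(5 log² x)`.
[cite: BennettMartinOBryantRechnitzer2018, Proposition 6.18] -/
theorem BMOR2018.psi_bound_log_sq_luZamanZhao (h11 : luZamanZhao2026_theorem11)
    (h612 : BMOR2018.lemma612_psi) {q : ℕ} [NeZero q] (hq : 10 ^ 5 ≤ q) (hqQ : q ≤ 10 ^ 10)
    (a : (ZMod q)ˣ) {x : ℝ} (hx : Real.exp (4 * BMOR2018.R₁ * Real.log q ^ 2) ≤ x) :
    |Literature.NumberTheory.Sieve.ParityWave0.chebyshevPsiMod q a x - x / q.totient| ≤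
      x / (5 * Real.log x ^ 2) :=
  BMOR2018.psi_bound_log_sq_of_noExceptionalZeroUpTo h612 (noExceptionalZeroUpTo_of_luZamanZhao h11)
    (by unfold BMOR2018.R₁; norm_num) hq hqQ a hx


/-- **The Page–Siegel–Walfisz estimate for all moduli `q ≤ 10¹⁰`, with absolute constants**
(`NonExceptionalModuliPNT.chebyshevPsiMod_bound_of_noExceptionalZeroUpTo` at `c₀ = 1/5`, conditional on
the named fact `luZamanZhao2026_theorem11`): there are `k, m > 0` such that for every `1 ≤ q ≤ 10¹⁰`,
every unit `a` mod `q` and every `x ≥ 2`,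
`|ψ(x; q, a) − x/φ(q)| ≤ k · (q (1 + log q)⁵/φ(q)) · x · exp(−m √(log x)/(1 + log q))` — no exceptional
modulus, no Siegel constant. [cite: LuZamanZhao2026, Theorem 1.1] -/
theorem chebyshevPsiMod_bound_luZamanZhao (h11 : luZamanZhao2026_theorem11) :
    ∃ k m : ℝ, 0 < k ∧ 0 < m ∧ ∀ q : ℕ, 1 ≤ q → q ≤ 10 ^ 10 → ∀ (a : (ZMod q)ˣ) (x : ℝ), 2 ≤ x →
      |Literature.NumberTheory.Sieve.ParityWave0.chebyshevPsiMod q a x - x / q.totient| ≤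
        k * ((q : ℝ) * (1 + Real.log q) ^ 5 / q.totient) * x *
          Real.exp (-(m * Real.sqrt (Real.log x) / (1 + Real.log q))) := by
  obtain ⟨k, m, hk, hm, h⟩ := chebyshevPsiMod_bound_of_noExceptionalZeroUpTo (c₀ := 1 / 5) (by norm_num)
  exact ⟨k, m, hk, hm, fun q hq hqQ a x hx ↦ h (10 ^ 10) (noExceptionalZeroUpTo_of_luZamanZhao h11) q hq
    hqQ a x hx⟩

end Literature.NumberTheory.LFunctions

end
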